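import Literature.Combinatorics.SimpleGraph.WeightedMatrixForestTheorem
import Literature.Combinatorics.SimpleGraph.SpanningTreeParentMap
import Literature.Combinatorics.StablePolynomials.AffineDeterminantalPencil
import Literature.Probability.NegativeDependence.NegativeAssociationHierarchy
import HarnessLib

/-!
# The spanning tree polynomial is real stable and the uniform (weighted) spanning tree measure is
# strongly Rayleigh, hence CNA+ (Borcea–Brändén–Liggett §3.4, with §3.1 Prop. 3.2 and §4.2 Thm. 4.9)

J. Borcea, P. Brändén, T. M. Liggett, *Negative dependence and the geometry of polynomials*, J. Amer. Math. Soc.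
22 (2009) 521–567 (arXiv:0707.2340, held `paper:arxiv-0707.2340`; numbering of the arXiv version), §3.4
"Graphs, Laplacians, Spanning Trees and the Random Cluster Model" (arXiv p. 12), verbatim:

> Let `G = (V,E)` be a graph with vertex set `V = [n]` and edge set `E`. Associate to each edge `e ∈ E` a
> variable `w_e`. If `e` connects `i` and `j` let `A_e` be the `n × n` positive semi-definite matrix with the
> `ii`-entry and the `jj`-entry equal to `1`, the `ij`-entry and `ji`-entry equal to `-1`, and all other entries
> equal to `0`. The Laplacian, `L(G)`, of `G` is defined by `L(G) = Σ_{e ∈ E} w_e A_e`. Let `f_G(z,w) = det(L(G) + Z)`.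
> Thus, by Proposition 3.2, `f_G` is a multi-affine real stable polynomial with non-negative coefficients. The
> Principal Minors Matrix-Tree Theorem says that `f_G(z,w) = Σ_F z^{roots(F)} w^{edges(F)}` […]. Since the class of
> stable polynomials is closed under differentiation and specialization of variables at real values we have that
> the spanning tree polynomial `T_G(w) = Σ_T w^T`, where the sum is over all spanning trees, is real stable
> (which is widely known). The corresponding probability measure is usually called the uniform random spanning
> tree measure and is consequently strongly Rayleigh.

and §4.2 Thm. 4.9 «If `μ ∈ 𝔓_n` is strongly Rayleigh then it is CNA+» (tree `StableOrZero.isCNAPlus`); §1 (arXiv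
p. 2): «Subsequently, Feder and Mihail [FM] proved that this measure [the uniform random spanning tree measure]
— and more generally any balanced matroid — is CNA».

## What is here (vocabulary of the sibling files)

For a simple graph `G` on a finite vertex type `V` (`[DecidableRel G.Adj]`), with one variable `x_e` for every
`e : Sym2 V` (only the variables of edges of `G` occur):

* §1 `IsSpanningTreeEdges G A` (the finite set `A ⊆ E(G)` of edges is the edge set of a spanning tree:
  `fromEdgeSet A` is a tree), **`ustWeight G`** — the uniform spanning tree weight on `2^{Sym2 V}`
  (`1` on spanning-tree edge sets, `0` elsewhere; its generating polynomial `multiAffine (ustWeight G)` IS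
  `T_G`), `edgeWeight G x` (arc weights `x_{{u,v}} [u ∼ v]`), `reducedLaplacian G x r` (the weighted Laplacian
  `L(G) = Σ_e x_e A_e` with the row and column of `r` deleted — the tree's `wLaplacian`).
* §2 Parent maps rooted at `r` along edges of `G` versus spanning-tree edge sets (after the tree's
  `SpanningTreeParentMap`): `treeEdges`, `prod_treeEdges`, `coe_treeEdges`, `isSpanningTreeEdges_treeEdges`,
  **`sum_rootedTrees_eq_sum_spanningTreeEdges`** (re-indexing a sum over rooted parent maps as a sum over
  spanning-tree edge sets).
* §3 **`det_reducedLaplacian_eq_sum_spanningTrees`** — KIRCHHOFF'S WEIGHTED MATRIX-TREE THEOREM: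
  `det L(G)^{(r)} = Σ_{T spanning tree} Π_{e ∈ T} x_e` in every commutative ring (from the tree's weighted
  matrix-forest theorem `WeightedMatrixForest.det_wLaplacian_submatrix_compl_singleton`), and
  `multiAffine_ustWeight` (`T_G = det L(G)^{(r)}` as polynomials).
* §4 `edgeLap G e` (the matrices `A_e`, as printed), `posSemidef_edgeLap`, `affinePencilMatrix_edgeLap`
  (`L(G)^{(r)} = Σ_e x_e A_e^{(r)}`), hence by Prop. 3.2 (tree `detAffinePencil_eq_zero_or_isRealStable`)
  **`stableOrZero_ustWeight`**: the uniform spanning tree weight is strongly Rayleigh (or zero — when `G` is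
  disconnected), **`isRealStable_spanningTreePoly`** («`T_G(w)` is real stable», `G` connected).
* §5 Consequences: **`isCNAPlus_ustWeight`** (BBL: «consequently strongly Rayleigh», + Thm. 4.9: CNA+),
  **`isNegAssoc_ustWeight`** (Feder–Mihail: the uniform spanning tree measure is negatively associated),
  `isRayleigh_ustWeight`, and the weighted spanning tree measures `T ↦ Π_{e ∈ T} c_e` (`c ≥ 0`, an external
  field): `stableOrZero_extField_ustWeight`, `isCNAPlus_extField_ustWeight`.

No `sorry`, no named fact, no instance/notation.

## References

* [BorceaBrandenLiggett2007] J. Borcea, P. Brändén, T. M. Liggett, JAMS 22 (2009); arXiv:0707.2340 — §3.4, §3.1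
  Prop. 3.2, §4.2 Thm. 4.9, §1 (Feder–Mihail).
* [FederMihail1992] T. Feder, M. Mihail, Balanced matroids, STOC 1992, §3 (uniform spanning trees — bases of a
  balanced matroid — are negatively associated); restated in [Pemantle2000] R. Pemantle, Towards a theory of
  negative dependence, J. Math. Phys. 41 (2000), §1.1 Example 1 and §1.5.
* [ChebotarevAgaev2002] P. Chebotarev, R. Agaev, LAA 356 (2002), §3 Thm 1 (Tutte's matrix-tree theorem, weighted).
-/

noncomputable section

open Finset Matrix MvPolynomial
open Literature.Combinatorics.Enumerative
open Literature.Combinatorics.SimpleGraph.WeightedMatrixForest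
open Literature.Combinatorics.SimpleGraph.SpanningTreeParentMap
open Literature.Combinatorics.StablePolynomials

namespace Literature.Probability.NegativeDependence

variable {V : Type*} [Fintype V] [DecidableEq V] (G : SimpleGraph V) [DecidableRel G.Adj]

/-! ## §1 Spanning-tree edge sets, the uniform spanning tree weight, the weighted Laplacian -/

section Defs

/-- `A` is the edge set of a spanning tree of `G`: `A ⊆ E(G)` and the graph with edge set `A` (on all of `V`)
is a tree. [cite: BorceaBrandenLiggett2007, §3.4 («the sum is over all spanning trees»)] -/
def IsSpanningTreeEdges (A : Finset (Sym2 V)) : Prop :=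
  A ⊆ G.edgeFinset ∧ (SimpleGraph.fromEdgeSet (A : Set (Sym2 V))).IsTree

open Classical in
/-- **The uniform spanning tree weight** of `G` on `2^{Sym2 V}`: `1` on the edge sets of spanning trees, `0`
elsewhere («the corresponding probability measure is usually called the uniform random spanning tree measure»;
unnormalised, as all weights of the sibling files). Its generating polynomial `multiAffine (ustWeight G)` is the
spanning tree polynomial `T_G(w) = Σ_T w^T`. [cite: BorceaBrandenLiggett2007, §3.4] -/
def ustWeight : Finset (Sym2 V) → ℝ := fun A => if IsSpanningTreeEdges G A then 1 else 0

omit [DecidableEq V] in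
/-- Unfolding `ustWeight`. [cite: BorceaBrandenLiggett2007, §3.4] -/
theorem ustWeight_apply (A : Finset (Sym2 V)) [Decidable (IsSpanningTreeEdges G A)] :
    ustWeight G A = if IsSpanningTreeEdges G A then 1 else 0 := by
  rw [ustWeight]
  congr

omit [DecidableEq V] in
/-- `ustWeight G ≥ 0`. [cite: BorceaBrandenLiggett2007, §3.4] -/
theorem ustWeight_nonneg (A : Finset (Sym2 V)) : 0 ≤ ustWeight G A := by
  classical
  rw [ustWeight_apply]
  split_ifs <;> norm_num

/-- **The arc weights of `G` with edge variables**: `a u v = x_{{u,v}}` if `u ∼ v`, else `0`.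
[cite: BorceaBrandenLiggett2007, §3.4 («Associate to each edge e ∈ E a variable w_e»)] -/
def edgeWeight {R : Type*} [CommRing R] (x : Sym2 V → R) : V → V → R :=
  fun u v => if G.Adj u v then x s(u, v) else 0

omit [Fintype V] [DecidableEq V] in
/-- Unfolding `edgeWeight`. [cite: BorceaBrandenLiggett2007, §3.4] -/
theorem edgeWeight_apply {R : Type*} [CommRing R] (x : Sym2 V → R) (u v : V) :
    edgeWeight G x u v = if G.Adj u v then x s(u, v) else 0 := rfl

/-- **The reduced weighted Laplacian** `L(G)^{(r)}`: the weighted Laplacian `L(G) = Σ_e x_e A_e` (the tree's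
`wLaplacian (edgeWeight G x)`) with the row and column of the root `r` deleted.
[cite: BorceaBrandenLiggett2007, §3.4 (L(G) = Σ_e w_e A_e)] [cite: ChebotarevAgaev2002, §3 Thm 1] -/
def reducedLaplacian {R : Type*} [CommRing R] (x : Sym2 V → R) (r : V) :
    Matrix ↥({r}ᶜ : Finset V) ↥({r}ᶜ : Finset V) R :=
  (wLaplacian (edgeWeight G x)).submatrix Subtype.val Subtype.val

/-- Unfolding `reducedLaplacian`. [cite: BorceaBrandenLiggett2007, §3.4] -/
theorem reducedLaplacian_def {R : Type*} [CommRing R] (x : Sym2 V → R) (r : V) :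
    reducedLaplacian G x r = (wLaplacian (edgeWeight G x)).submatrix Subtype.val Subtype.val := rfl

end Defs

/-! ## §2 Parent maps rooted at `r` along edges of `G` ↔ edge sets of spanning trees -/

section ParentMaps

variable {G}
variable {r : V} {τ : V → V}

/-- The root is fixed. [cite: BorceaBrandenLiggett2007, §3.4 (rooted spanning forests)] -/
private theorem apply_root (h : IsForestOn (univ : Finset V) {r} τ) : τ r = r :=
  (isForestOn_univ_singleton_iff.1 h).1

/-- A non-root vertex is moved. [folklore] -/
private theorem apply_ne_self (h : IsForestOn (univ : Finset V) {r} τ) {v : V} (hv : v ≠ r) : τ v ≠ v := by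
  intro heq
  obtain ⟨n, hn⟩ := (isForestOn_univ_singleton_iff.1 h).2 v
  rw [Function.iterate_fixed heq n] at hn
  exact hv hn

/-- No `2`-cycles off the root. [folklore] -/
private theorem no_two_cycle (h : IsForestOn (univ : Finset V) {r} τ) {v w : V} (hv : v ≠ r) (hw : w ≠ r)
    (h1 : τ v = w) (h2 : τ w = v) : False := by
  obtain ⟨n, hn⟩ := (isForestOn_univ_singleton_iff.1 h).2 v
  have key : ∀ m : ℕ, τ^[m] v = v ∨ τ^[m] v = w := by
    intro m
    induction m with
    | zero => exact Or.inl rfl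
    | succ m ih =>
      rw [Function.iterate_succ_apply']
      rcases ih with h' | h'
      · rw [h', h1]; exact Or.inr rfl
      · rw [h', h2]; exact Or.inl rfl
  rcases key n with h' | h'
  · exact hv (h'.symm.trans hn)
  · exact hw (h'.symm.trans hn)

/-- The edge set `{ {v, τ v} : v ≠ r }` of a parent map rooted at `r`. [cite: BorceaBrandenLiggett2007, §3.4
(`edges(F)`)] -/
def treeEdges (τ : V → V) (r : V) : Finset (Sym2 V) := (univ.erase r).image fun v => s(v, τ v)

/-- `v ↦ {v, τ v}` is injective off the root. [folklore] -/
private theorem injOn_edge (h : IsForestOn (univ : Finset V) {r} τ) :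
    Set.InjOn (fun v => s(v, τ v)) ↑(univ.erase r) := by
  intro v hv w hw hvw
  simp only [coe_erase, coe_univ, Set.mem_sdiff, Set.mem_univ, Set.mem_singleton_iff, true_and] at hv hw
  rcases Sym2.eq_iff.1 hvw with ⟨h1, -⟩ | ⟨h1, h2⟩
  · exact h1
  · exact (no_two_cycle h hv hw h2 h1.symm).elim

/-- `Π_{e ∈ treeEdges τ r} f e = Π_{v ≠ r} f {v, τ v}`. [cite: BorceaBrandenLiggett2007, §3.4 (`w^{edges(F)}`)] -/
theorem prod_treeEdges {R : Type*} [CommMonoid R] (h : IsForestOn (univ : Finset V) {r} τ) (f : Sym2 V → R) :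
    ∏ e ∈ treeEdges τ r, f e = ∏ v ∈ univ.erase r, f s(v, τ v) := by
  rw [treeEdges, prod_image (injOn_edge h)]

omit [Fintype V] [DecidableEq V] in
/-- Adjacency in the graph of `τ`. [folklore] -/
private theorem fromRel_adj_iff (τ : V → V) (v w : V) :
    (SimpleGraph.fromRel fun x y => τ x = y).Adj v w ↔ v ≠ w ∧ (τ v = w ∨ τ w = v) :=
  SimpleGraph.fromRel_adj _ v w

/-- The edge set of `τ` is the edge set of the graph of `τ` (the tree's `SpanningTreeParentMap` vocabulary:
«edges(F) ⊆ E is the set of edges used in F»). [cite: BorceaBrandenLiggett2007, §3.4 (`edges(F)`)]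
[cite: AignerZiegler1998, Ch. 26 (first proof: the graph of a map)] -/
theorem coe_treeEdges (h : IsForestOn (univ : Finset V) {r} τ) :
    (treeEdges τ r : Set (Sym2 V)) = (SimpleGraph.fromRel fun x y => τ x = y).edgeSet := by
  ext e
  induction e using Sym2.ind with
  | h a b =>
    rw [treeEdges, coe_image, SimpleGraph.mem_edgeSet, fromRel_adj_iff]
    simp only [coe_erase, coe_univ, Set.mem_image, Set.mem_sdiff, Set.mem_univ, Set.mem_singleton_iff,
      true_and]
    constructor
    · rintro ⟨v, hv, hvab⟩
      rcases Sym2.eq_iff.1 hvab with ⟨rfl, rfl⟩ | ⟨rfl, rfl⟩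
      · exact ⟨(apply_ne_self h hv).symm, Or.inl rfl⟩
      · exact ⟨apply_ne_self h hv, Or.inr rfl⟩
    · rintro ⟨hab, h1 | h1⟩
      · refine ⟨a, fun har => hab ?_, by rw [h1]⟩
        rw [← h1, har, apply_root h]
      · refine ⟨b, fun hbr => hab ?_, by rw [h1, Sym2.eq_swap]⟩
        rw [← h1, hbr, apply_root h]

/-- Along edges of `G` the edge set of `τ` lies in `E(G)`. [folklore] -/
private theorem treeEdges_subset (hadj : ∀ v, v ≠ r → G.Adj v (τ v)) : treeEdges τ r ⊆ G.edgeFinset := by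
  intro e he
  obtain ⟨v, hv, rfl⟩ := mem_image.1 he
  rw [SimpleGraph.mem_edgeFinset, SimpleGraph.mem_edgeSet]
  exact hadj v (ne_of_mem_erase hv)

/-- The edge set of a parent map rooted at `r` along edges of `G` is the edge set of a spanning tree of `G`
(the graph of `τ` is a tree: tree `SpanningTreeParentMap.isTree_fromRel`). [cite: BorceaBrandenLiggett2007,
§3.4] -/
theorem isSpanningTreeEdges_treeEdges (h : IsForestOn (univ : Finset V) {r} τ) (hadj : ∀ v, v ≠ r → G.Adj v (τ v)) :
    IsSpanningTreeEdges G (treeEdges τ r) := by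
  refine ⟨treeEdges_subset hadj, ?_⟩
  rw [coe_treeEdges h, SimpleGraph.fromEdgeSet_edgeSet]
  exact isTree_fromRel h

omit [Fintype V] [DecidableEq V] [DecidableRel G.Adj] in
/-- A set of edges of `G` contains no loops. [folklore] -/
private theorem sdiff_diagSet_eq {A : Finset (Sym2 V)} (hA : (A : Set (Sym2 V)) ⊆ G.edgeSet) :
    (A : Set (Sym2 V)) \ Sym2.diagSet = A := by
  ext e
  simp only [Set.mem_sdiff, Sym2.mem_diagSet, and_iff_left_iff_imp]
  exact fun he => SimpleGraph.not_isDiag_of_mem_edgeSet _ (hA he)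

open Classical in
/-- **Re-indexing by spanning trees**: summing `f` over the edge sets of the parent maps rooted at `r` along
edges of `G` is summing `f` over the edge sets of the spanning trees of `G` (the map `τ ↦ treeEdges τ r` is a
bijection: injective by `SpanningTreeParentMap.eq_of_fromRel_eq`, surjective by
`SpanningTreeParentMap.exists_isForestOn_of_isTree_le`). [cite: BorceaBrandenLiggett2007, §3.4 (rooted spanning
forests with one root = spanning trees)] -/
theorem sum_rootedTrees_eq_sum_spanningTreeEdges {M : Type*} [AddCommMonoid M] (r : V) (f : Finset (Sym2 V) → M) :
    ∑ τ ∈ (forests (univ : Finset V) {r}).filter (fun τ => ∀ v, v ≠ r → G.Adj v (τ v)), f (treeEdges τ r) =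
      ∑ A ∈ (univ : Finset (Finset (Sym2 V))).filter (IsSpanningTreeEdges G), f A := by
  refine sum_bij (fun τ _ => treeEdges τ r) ?_ ?_ ?_ (fun _ _ => rfl)
  · intro τ hτ
    rw [mem_filter, mem_forests] at hτ
    exact mem_filter.2 ⟨mem_univ _, isSpanningTreeEdges_treeEdges hτ.1 hτ.2⟩
  · intro τ₁ h₁ τ₂ h₂ heq
    rw [mem_filter, mem_forests] at h₁ h₂
    have hset := congrArg (fun A : Finset (Sym2 V) => (A : Set (Sym2 V))) heq
    simp only [coe_treeEdges h₁.1, coe_treeEdges h₂.1, SimpleGraph.edgeSet_inj] at hset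
    exact eq_of_fromRel_eq h₁.1 h₂.1 hset
  · intro A hA
    obtain ⟨hAE, hT⟩ := (mem_filter.1 hA).2
    have hAE' : (A : Set (Sym2 V)) ⊆ G.edgeSet := by
      rw [← SimpleGraph.coe_edgeFinset]; exact coe_subset.2 hAE
    have hTG : SimpleGraph.fromEdgeSet (A : Set (Sym2 V)) ≤ G := by
      calc SimpleGraph.fromEdgeSet (A : Set (Sym2 V)) ≤ SimpleGraph.fromEdgeSet G.edgeSet :=
            SimpleGraph.fromEdgeSet_mono hAE'
        _ = G := SimpleGraph.fromEdgeSet_edgeSet G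
    obtain ⟨τ, hτ, hadj, hfrom⟩ := exists_isForestOn_of_isTree_le hT hTG r
    refine ⟨τ, mem_filter.2 ⟨mem_forests.2 hτ, hadj⟩, ?_⟩
    rw [← Finset.coe_inj, coe_treeEdges hτ, hfrom, SimpleGraph.edgeSet_fromEdgeSet, sdiff_diagSet_eq hAE']

end ParentMaps

/-! ## §3 Kirchhoff's weighted matrix-tree theorem; `T_G` is a reduced Laplacian determinant -/

section Kirchhoff

open Classical in
/-- **Kirchhoff's weighted matrix-tree theorem** for a simple graph with edge weights `x_e` in a commutative
ring: `det L(G)^{(r)} = Σ_{T spanning tree of G} Π_{e ∈ T} x_e` for every root `r` (one-root case of the weighted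
matrix-forest theorem, re-indexed by spanning trees; a parent map using a non-edge of `G` has weight `0`).
[cite: BorceaBrandenLiggett2007, §3.4 (Principal Minors Matrix-Tree Theorem, `T_G(w) = Σ_T w^T`)]
[cite: ChebotarevAgaev2002, §3 Thm 1] -/
theorem det_reducedLaplacian_eq_sum_spanningTrees {R : Type*} [CommRing R] (x : Sym2 V → R) (r : V) :
    (reducedLaplacian G x r).det =
      ∑ A ∈ (univ : Finset (Finset (Sym2 V))).filter (IsSpanningTreeEdges G), ∏ e ∈ A, x e := by
  rw [reducedLaplacian_def, det_wLaplacian_submatrix_compl_singleton,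
    ← sum_rootedTrees_eq_sum_spanningTreeEdges r (fun A => ∏ e ∈ A, x e), sum_filter]
  refine sum_congr rfl fun τ hτ => ?_
  rw [mem_forests] at hτ
  split_ifs with hadj
  · show ∏ v ∈ univ.erase r, edgeWeight G x v (τ v) = ∏ e ∈ treeEdges τ r, x e
    rw [prod_treeEdges hτ]
    exact prod_congr rfl fun v hv => by rw [edgeWeight_apply, if_pos (hadj v (ne_of_mem_erase hv))]
  · obtain ⟨v, hv⟩ := not_forall.1 hadj
    obtain ⟨hv, hv'⟩ := Classical.not_imp.1 hv
    exact prod_eq_zero (mem_erase.2 ⟨hv, mem_univ v⟩) (by rw [edgeWeight_apply, if_neg hv'])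

open Classical in
/-- **`T_G = det L(G)^{(r)}`**: the generating polynomial of the uniform spanning tree weight (the spanning tree
polynomial `T_G(w) = Σ_T w^T`) is the reduced weighted Laplacian determinant, for every root `r`.
[cite: BorceaBrandenLiggett2007, §3.4] -/
theorem multiAffine_ustWeight (r : V) :
    multiAffine (ustWeight G) = (reducedLaplacian G (fun e => (X e : MvPolynomial (Sym2 V) ℝ)) r).det := by
  rw [det_reducedLaplacian_eq_sum_spanningTrees, multiAffine, sum_filter]
  refine sum_congr rfl fun A _ => ?_
  rw [ustWeight_apply]
  split_ifs <;> simp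

end Kirchhoff

/-! ## §4 `L(G)^{(r)} = Σ_e x_e A_e^{(r)}` with `A_e ⪰ 0`: `T_G` is real stable (or zero) -/

section Pencil

/-- **The matrices `A_e`** (as printed: for `e = {i,j} ∈ E`, the `ii`- and `jj`-entries `1`, the `ij`- and
`ji`-entries `-1`, all others `0`; for `e ∉ E(G)` the zero matrix). [cite: BorceaBrandenLiggett2007, §3.4] -/
def edgeLap (e : Sym2 V) : Matrix V V ℝ :=
  Matrix.of fun p q =>
    if e ∈ G.edgeSet then (if p = q then (if p ∈ e then 1 else 0) else (if s(p, q) = e then -1 else 0)) else 0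

omit [Fintype V] in
/-- Unfolding `edgeLap`. [cite: BorceaBrandenLiggett2007, §3.4] -/
theorem edgeLap_apply (e : Sym2 V) (p q : V) :
    edgeLap G e p q =
      if e ∈ G.edgeSet then (if p = q then (if p ∈ e then 1 else 0) else (if s(p, q) = e then -1 else 0))
      else 0 := rfl

omit [Fintype V] [DecidableRel G.Adj] in
/-- `A_{{u,v}} = b bᵀ` with `b = 𝟙_u - 𝟙_v` (`u ≠ v`), entrywise. [cite: BorceaBrandenLiggett2007, §3.4 («positive
semi-definite matrix»)] -/
private theorem edgeLap_entry_eq {u v : V} (huv : u ≠ v) (p q : V) :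
    (if p = q then (if p ∈ s(u, v) then (1 : ℝ) else 0) else (if s(p, q) = s(u, v) then -1 else 0)) =
      ((if p = u then (1 : ℝ) else 0) - (if p = v then 1 else 0)) *
        ((if q = u then (1 : ℝ) else 0) - (if q = v then 1 else 0)) := by
  by_cases hpq : p = q
  · subst hpq
    rw [if_pos rfl]
    by_cases hpu : p = u
    · subst hpu
      norm_num [huv]
    · by_cases hpv : p = v
      · subst hpv
        norm_num [hpu]
      · norm_num [hpu, hpv]
  · rw [if_neg hpq]
    by_cases hpu : p = u
    · subst hpu
      by_cases hqv : q = v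
      · subst hqv
        norm_num [hpq, Ne.symm hpq]
      · norm_num [hqv, Ne.symm hpq, huv, Sym2.eq_iff]
    · by_cases hpv : p = v
      · subst hpv
        by_cases hqu : q = u
        · subst hqu
          norm_num [hpq, huv, Sym2.eq_iff]
        · norm_num [hqu, hpu, Ne.symm hpq, Sym2.eq_iff]
      · norm_num [hpu, hpv, Sym2.eq_iff]

/-- **`A_e` is positive semidefinite** (`A_{{u,v}} = b bᵀ`, `b = 𝟙_u - 𝟙_v`). [cite: BorceaBrandenLiggett2007,
§3.4 («the n × n positive semi-definite matrix A_e»)] -/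
theorem posSemidef_edgeLap (e : Sym2 V) : (edgeLap G e).PosSemidef := by
  by_cases he : e ∈ G.edgeSet
  · induction e using Sym2.ind with
    | h u v =>
      have huv : u ≠ v := ((SimpleGraph.mem_edgeSet G).1 he).ne
      have hmat : edgeLap G s(u, v) =
          vecMulVec (fun p => (if p = u then (1 : ℝ) else 0) - (if p = v then 1 else 0))
            (star fun p => (if p = u then (1 : ℝ) else 0) - (if p = v then 1 else 0)) := by
        refine Matrix.ext fun p q => ?_
        rw [edgeLap_apply, if_pos he, vecMulVec_apply, Pi.star_apply, star_trivial]
        exact edgeLap_entry_eq huv p q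
      rw [hmat]
      exact posSemidef_vecMulVec_self_star _
  · have h0 : edgeLap G e = 0 := by
      refine Matrix.ext fun p q => ?_
      rw [edgeLap_apply, if_neg he]
      rfl
    rw [h0]
    exact Matrix.PosSemidef.zero

/-- The diagonal of `Σ_e x_e A_e`: `Σ_{e ∈ E, p ∈ e} x_e = Σ_{w ∼ p} x_{{p,w}}` (incident edges ↔ neighbours).
[folklore] -/
private theorem sum_edge_diag {R : Type*} [AddCommMonoid R] (x : Sym2 V → R) (p : V) :
    ∑ e : Sym2 V, (if e ∈ G.edgeSet then (if p ∈ e then x e else 0) else 0) =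
      ∑ w ∈ univ.erase p, if G.Adj p w then x s(p, w) else 0 := by
  have hL : ∑ e : Sym2 V, (if e ∈ G.edgeSet then (if p ∈ e then x e else 0) else 0) =
      ∑ e ∈ (univ : Finset (Sym2 V)).filter (fun e => e ∈ G.edgeSet ∧ p ∈ e), x e := by
    rw [sum_filter]
    refine sum_congr rfl fun e _ => ?_
    by_cases h1 : e ∈ G.edgeSet <;> by_cases h2 : p ∈ e <;> simp [h1, h2]
  rw [hL, ← sum_filter]
  symm
  refine sum_bij (fun w _ => s(p, w)) ?_ ?_ ?_ (fun _ _ => rfl)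
  · intro w hw
    simp only [mem_filter, mem_erase, mem_univ, and_true] at hw
    exact mem_filter.2 ⟨mem_univ _, (SimpleGraph.mem_edgeSet G).2 hw.2, Sym2.mem_mk_left _ _⟩
  · intro w₁ _ w₂ _ h
    exact Sym2.congr_right.1 h
  · intro e he
    obtain ⟨-, he1, he2⟩ := mem_filter.1 he
    obtain ⟨w, rfl⟩ := Sym2.mem_iff_exists.1 he2
    rw [SimpleGraph.mem_edgeSet] at he1
    exact ⟨w, mem_filter.2 ⟨mem_erase.2 ⟨he1.ne', mem_univ _⟩, he1⟩, rfl⟩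

/-- **`L(G)^{(r)} = Σ_e x_e A_e^{(r)}`**: the reduced weighted Laplacian with edge variables is the affine
determinantal pencil of the (reduced) matrices `A_e` with `B = 0` (tree `affinePencilMatrix`).
[cite: BorceaBrandenLiggett2007, §3.4 («L(G) := Σ_{e∈E} w_e A_e»)] -/
theorem affinePencilMatrix_edgeLap (r : V) :
    affinePencilMatrix (fun e => (edgeLap G e).submatrix (Subtype.val : ↥({r}ᶜ : Finset V) → V) Subtype.val) 0 =
      reducedLaplacian G (fun e => (X e : MvPolynomial (Sym2 V) ℝ)) r := by
  refine Matrix.ext fun p q => ?_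
  rw [affinePencilMatrix_apply, reducedLaplacian_def, submatrix_apply, Matrix.zero_apply, C_0, add_zero]
  simp only [submatrix_apply]
  by_cases hpq : (p : V) = q
  · have hpq' : p = q := Subtype.ext hpq
    subst hpq'
    rw [wLaplacian_apply_self]
    simp only [edgeWeight_apply]
    rw [← sum_edge_diag (R := MvPolynomial (Sym2 V) ℝ) G X (p : V)]
    refine sum_congr rfl fun e _ => ?_
    rw [edgeLap_apply, if_pos (rfl : (p : V) = p)]
    split_ifs <;> simp
  · rw [wLaplacian_apply_of_ne _ hpq, edgeWeight_apply]
    have h1 : ∀ e : Sym2 V, C (edgeLap G e p q) * X e =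
        if e = s((p : V), (q : V)) then (if G.Adj p q then -X e else 0) else 0 := by
      intro e
      rw [edgeLap_apply, if_neg hpq]
      by_cases he : e = s((p : V), (q : V))
      · subst he
        have h2 : (if s((p : V), (q : V)) = s((p : V), (q : V)) then (-1 : ℝ) else 0) = -1 := if_pos rfl
        rw [h2, if_pos (rfl : s((p : V), (q : V)) = s((p : V), (q : V)))]
        by_cases hadj : G.Adj (p : V) (q : V)
        · rw [if_pos ((SimpleGraph.mem_edgeSet G).2 hadj), if_pos hadj]
          simp
        · rw [if_neg (mt (SimpleGraph.mem_edgeSet G).1 hadj), if_neg hadj]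
          simp
      · rw [if_neg he]
        have h2 : ¬s((p : V), (q : V)) = e := fun h => he h.symm
        rw [if_neg h2, ite_self, C_0, zero_mul]
    simp_rw [h1]
    rw [sum_ite_eq', if_pos (mem_univ _)]
    split_ifs <;> simp

/-- **`T_G(w) = det(Σ_e w_e A_e^{(r)})`** — the spanning tree polynomial as an affine determinantal pencil with
positive semidefinite coefficients. [cite: BorceaBrandenLiggett2007, §3.4] -/
theorem multiAffine_ustWeight_eq_detAffinePencil (r : V) :
    multiAffine (ustWeight G) =
      detAffinePencil (fun e => (edgeLap G e).submatrix (Subtype.val : ↥({r}ᶜ : Finset V) → V) Subtype.val) 0 := by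
  rw [detAffinePencil, affinePencilMatrix_edgeLap, multiAffine_ustWeight G r]

/-- **The uniform spanning tree measure is strongly Rayleigh**: the generating polynomial `T_G` of
`ustWeight G` is real stable or identically zero (the latter iff `G` has no spanning tree) — Prop. 3.2 applied
to `L(G)^{(r)} = Σ_e w_e A_e^{(r)}`, `A_e ⪰ 0`. [cite: BorceaBrandenLiggett2007, §3.4 («T_G(w) … is real stable …
The corresponding probability measure is usually called the uniform random spanning tree measure and is
consequently strongly Rayleigh»)] -/
theorem stableOrZero_ustWeight : StableOrZero (ustWeight G) := by
  classical
  rcases isEmpty_or_nonempty V with hV | ⟨⟨r⟩⟩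
  · refine Or.inl fun A => ?_
    rw [ustWeight_apply, if_neg]
    intro h
    exact hV.false h.2.connected.nonempty.some
  · rw [stableOrZero_iff, multiAffine_ustWeight_eq_detAffinePencil G r]
    exact detAffinePencil_eq_zero_or_isRealStable (fun e => (posSemidef_edgeLap G e).submatrix _)
      Matrix.isHermitian_zero

omit [DecidableEq V] in
/-- The edge set of a spanning tree `T ≤ G` is a spanning-tree edge set. [cite: BorceaBrandenLiggett2007, §3.4] -/
theorem isSpanningTreeEdges_edgeFinset {T : SimpleGraph V} [DecidableRel T.Adj] (hT : T.IsTree) (hTG : T ≤ G) :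
    IsSpanningTreeEdges G T.edgeFinset := by
  refine ⟨SimpleGraph.edgeFinset_subset_edgeFinset.2 hTG, ?_⟩
  rwa [SimpleGraph.coe_edgeFinset, SimpleGraph.fromEdgeSet_edgeSet]

/-- **«The spanning tree polynomial `T_G(w) = Σ_T w^T` is real stable»** (`G` connected, so that `T_G ≠ 0`).
[cite: BorceaBrandenLiggett2007, §3.4] -/
theorem isRealStable_spanningTreePoly (hG : G.Connected) : IsRealStable (multiAffine (ustWeight G)) := by
  classical
  rcases stableOrZero_ustWeight G with h0 | hst
  · exfalso
    obtain ⟨T, hTG, hT⟩ := hG.exists_isTree_le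
    have h1 : ustWeight G T.edgeFinset = 1 := by
      rw [ustWeight_apply, if_pos (isSpanningTreeEdges_edgeFinset G hT hTG)]
    exact one_ne_zero (h1.symm.trans (h0 _))
  · exact (isRealStable_multiAffine_iff _).2 hst

/-- Equivalently: `det L(G)^{(r)}` (edge variables) is a real stable polynomial for connected `G`.
[cite: BorceaBrandenLiggett2007, §3.4] -/
theorem isRealStable_det_reducedLaplacian (hG : G.Connected) (r : V) :
    IsRealStable (reducedLaplacian G (fun e => (X e : MvPolynomial (Sym2 V) ℝ)) r).det := by
  rw [← multiAffine_ustWeight G r]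
  exact isRealStable_spanningTreePoly G hG

end Pencil

/-! ## §5 Consequences: CNA+, negative association, weighted spanning trees -/

section Consequences

/-- **The uniform spanning tree measure is CNA+** (strongly Rayleigh ⟹ CNA+, Thm. 4.9).
[cite: BorceaBrandenLiggett2007, §3.4 with §4.2 Thm. 4.9] -/
theorem isCNAPlus_ustWeight : IsCNAPlus (ustWeight G) :=
  (stableOrZero_ustWeight G).isCNAPlus (ustWeight_nonneg G)

/-- **The uniform spanning tree measure is negatively associated** (Feder–Mihail; here via strongly Rayleigh
⟹ CNA+ ⟹ CNA ⟹ NA). [cite: FederMihail1992, §3 (the uniform measure on the bases of a balanced matroid — in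
particular the uniform spanning tree — is negatively associated; restated in Pemantle2000 §1.1 Ex. 1 and §1.5)]
[cite: Pemantle2000, §1.5 («Feder and Mihail (1992) prove that a uniform random base for a balanced matroid, of
which the uniform spanning tree measure is a special case, has the negative association property»)]
[cite: BorceaBrandenLiggett2007, §1 («Feder and Mihail [FM] proved that this measure … is CNA»)] -/
theorem isNegAssoc_ustWeight : IsNegAssoc (ustWeight G) :=
  (isCNAPlus_ustWeight G).isCNA.isNegAssoc

/-- The uniform spanning tree measure is CNA. [cite: BorceaBrandenLiggett2007, §1 (Feder–Mihail: CNA)] -/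
theorem isCNA_ustWeight : IsCNA (ustWeight G) :=
  (isCNAPlus_ustWeight G).isCNA

/-- The uniform spanning tree measure is a Rayleigh measure. [cite: BorceaBrandenLiggett2007, §3.4 with §4.1
Thm. 4.1 (strongly Rayleigh ⟹ Rayleigh)] -/
theorem isRayleigh_ustWeight : IsRayleigh (ustWeight G) :=
  (isCNAPlus_ustWeight G).isRayleigh

/-- **Weighted spanning trees**: for edge weights `c ≥ 0` the weighted spanning tree measure
`T ↦ Π_{e ∈ T} c_e` (= `extField c (ustWeight G)`, i.e. `T_G` specialised at `w_e ↦ c_e w_e`) is strongly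
Rayleigh (or zero). [cite: BorceaBrandenLiggett2007, §3.4 (T_G(w) real stable) with §4.2 (external fields
preserve strongly Rayleigh)] -/
theorem stableOrZero_extField_ustWeight {c : Sym2 V → ℝ} (hc : ∀ e, 0 ≤ c e) :
    StableOrZero (extField c (ustWeight G)) :=
  stableOrZero_extField (stableOrZero_ustWeight G) hc

omit [DecidableEq V] in
/-- The weighted spanning tree measure puts weight `Π_{e ∈ T} c_e` on a spanning-tree edge set `T` and `0`
elsewhere. [cite: BorceaBrandenLiggett2007, §3.4] -/
theorem extField_ustWeight_apply (c : Sym2 V → ℝ) (A : Finset (Sym2 V)) [Decidable (IsSpanningTreeEdges G A)] :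
    extField c (ustWeight G) A = if IsSpanningTreeEdges G A then ∏ e ∈ A, c e else 0 := by
  rw [extField_apply, ustWeight_apply]
  split_ifs <;> simp

/-- **Weighted spanning tree measures are CNA+** (hence CNA, NA, Rayleigh). [cite: BorceaBrandenLiggett2007,
§3.4 with §4.2 Thm. 4.9] -/
theorem isCNAPlus_extField_ustWeight {c : Sym2 V → ℝ} (hc : ∀ e, 0 ≤ c e) :
    IsCNAPlus (extField c (ustWeight G)) :=
  isCNAPlus_extField (isCNAPlus_ustWeight G) hc

/-- Weighted spanning tree measures are negatively associated. [cite: BorceaBrandenLiggett2007, §3.4 with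
§4.2 Thm. 4.9] [cite: Pemantle2000, §1.5 (Feder–Mihail)] -/
theorem isNegAssoc_extField_ustWeight {c : Sym2 V → ℝ} (hc : ∀ e, 0 ≤ c e) :
    IsNegAssoc (extField c (ustWeight G)) :=
  (isCNAPlus_extField_ustWeight G hc).isCNA.isNegAssoc

open Classical in
/-- **The partition function**: the number of spanning trees `T_G(1,…,1) = Σ_A ustWeight G A` is the reduced
determinant of the combinatorial Laplacian (Kirchhoff; tree `wLaplacian_adj` identifies the `0/1` weighted
Laplacian with Mathlib's `lapMatrix`). [cite: BorceaBrandenLiggett2007, §3.4 (uniform random spanning tree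
measure)] [cite: ChebotarevAgaev2002, §3 Thm 1] -/
theorem sum_ustWeight_eq_det (r : V) :
    ∑ A, ustWeight G A = ((G.lapMatrix ℝ).submatrix (Subtype.val : ↥({r}ᶜ : Finset V) → V) Subtype.val).det := by
  have h := det_reducedLaplacian_eq_sum_spanningTrees G (fun _ : Sym2 V => (1 : ℝ)) r
  have hw : edgeWeight G (fun _ : Sym2 V => (1 : ℝ)) = fun u v => if G.Adj u v then (1 : ℝ) else 0 := by
    funext u v
    rw [edgeWeight_apply]
  rw [reducedLaplacian_def, hw, wLaplacian_adj] at h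
  rw [h, sum_filter]
  refine sum_congr rfl fun A _ => ?_
  rw [ustWeight_apply]
  split_ifs <;> simp

end Consequences

end Literature.Probability.NegativeDependence
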